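import Literature.Probability.RandomPlanarGeometry.SAWCountZdFourthCoefficient
import Literature.Probability.RandomPlanarGeometry.SAWPulledLargeForceExpansionZdBridgeWords
import HarnessLib

/-!
# The second axis class of the span-two cell, I: rigidity and locality of the bridge words of cost `c` and length `c + 2`

Topic `Literature/Probability/RandomPlanarGeometry` (after `SAWIrreducibleBridgeSpanTwoTopClass(Count).lean` (a-p1 g18: the TOP class
`F_{c,c+2}(c−2) = C(c−1,3)(c−2)!2^{c−2}`), on a-p3 g20's word model `SAWPulledLargeForceExpansionZdBridgeWords.lean` (`QB c u`: self-avoiding,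
irreducible bridge along the axis of the first letter, cost `c`; `Hgt`, `vs`; `costCoeffZd_eq_card_qb`, `qb_iff_canon`) and the planted-pattern
tools `SAWCountZdPlantedPatternCounts.lean` / `SAWCountZdFourthCoefficient.lean` (a-p1 g21)).

PRINTED CONTEXT (locators only; nothing quoted). Madras–Slade (1993) §4.2 p. 94 (cost = length − span; down steps of irreducible bridges),
Definition 1.2.4, §1.1 p. 3 (unit squares). NOT IN PRINT (lane statements): everything below — the structural half of the census law (L2′)
(`F_{c,c+2}(c−3) = (c−3)!·2^{c−3}·(c⁵−12c⁴+59c³−162c²+276c−234)/6`, the last hypothesis of Am. BC's fourth-symbol law after (L1)).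

THIS FILE (lane «pcv-sawmu», a-p1 g21; all PROVED, standard axioms; tool notions `IsSkel`, `LocalOK` — not notions in print):
* heights as letter counts: `vs_self`/`vs_revIdx`/`vs_of_fst_ne`, `vs_eq_ite_sub_ite`, `hgt_eq_of_vertical`, `hgt_last_eq_card_sub_card`
  (final height = #f − #f̄), ★ `numAxes_add_card_vertical_le` (`numAxes + #f + #f̄ ≤ n + 2`);
* SKELETON WORDS `IsSkel p q r u` (letters `f, f, f̄, f` at `0 < p < q < r`, `p + 2 ≤ q`, `q + 2 ≤ r ≤ n`, every other letter off the axis of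
  `f = u 0`): `IsSkel.hgt_eq` (heights `[0<i]+[p<i]−[q<i]+[r<i]`), ★ `IsSkel.isIrrH` (an irreducible bridge: heights 1, 2 only and the down step
  kills every renewal time);
* ★★ RIGIDITY `exists_isSkel_of_qb`: a word of length `c + 2` in the bridge class of cost `c` with at least `c − 2` axes IS a skeleton word
  (`#f − #f̄ = 2` and `#f + #f̄ ≤ 4`; no down step would make the second up step a renewal time; the bridge bounds order `p < q < r`; self-avoidance
  separates them); `numAxes_le_of_qb` (`numAxes + 2 ≤ n`);
* THE LOCAL EXCLUSIONS `LocalOK p q r u` — no reversed pair of ADJACENT lateral letters and none of the four vertical unit squares `b U₂ b̄ D`,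
  `U₂ b D b̄`, `b D b̄ U₃`, `D b U₃ b̄`: ★ `localOK_of_isSAW` (each violation is a zero block) and ★★ `isSAW_of_localOK` (a skeleton word with at
  most one lateral axis coincidence — `numAxes ≥ n − 3` — satisfying them is self-avoiding: a zero block has vertical letters `{p,q}` or
  `{q,r}` or none, every lateral letter of it has a reversed partner inside, and three lateral letters would be two coincidences);
* ★★★ `qb_iff_exists_isSkel_localOK`: for `n = c + 1` and `numAxes u ≥ c − 2`, `QB c u ↔ ∃ p q r, IsSkel p q r u ∧ LocalOK p q r u`.
[cite: MadrasSlade1993, §4.2 (p. 94); Definition 1.2.4; §1.1 (p. 3)]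

Provenance: lane «pcv-sawmu», a-p1 g21 (2026-08-27).
-/

noncomputable section

open Finset
open scoped BigOperators
open Literature.Probability.LatticeModels
open Literature.Probability.RandomPlanarGeometry.SAW
open Literature.Probability.Percolation

namespace Literature.Probability.RandomPlanarGeometry.SAW.Zd

namespace WordTypes

section SpanTwoRigidity

variable {n D : ℕ}

/-! ### Heights as letter counts -/

/-- The vertical sign of the first letter is `1`, of its reverse `−1`, of a letter off its axis `0`. [cite: MadrasSlade1993, Definition 1.2.4; lane plumbing] -/
theorem vs_self (f : Idx D) : vs f f = 1 := by simp [vs]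

/-- See `vs_self`. [cite: MadrasSlade1993, Definition 1.2.4; lane plumbing] -/
theorem vs_revIdx (f : Idx D) : vs f (revIdx f) = -1 := by
  obtain ⟨x, s⟩ := f
  cases s <;> simp [vs, revIdx]

/-- See `vs_self`. [cite: MadrasSlade1993, Definition 1.2.4; lane plumbing] -/
theorem vs_of_fst_ne (f a : Idx D) (h : a.1 ≠ f.1) : vs f a = 0 := by simp [vs, h]

/-! ### The skeleton of a span-two bridge word: `f … f … f̄ … f`, every other letter lateral -/

/-- `IsSkel p q r u`: the letters at `0, p, q, r` are `f, f, f̄, f` (`f = u 0`) and every other letter is off the axis of `f`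
(admissibility `1 ≤ p`, `p + 2 ≤ q`, `q + 2 ≤ r ≤ n` is part of the predicate). [cite: MadrasSlade1993, §4.2 (p. 94); lane tool notion] -/
def IsSkel (p q r : ℕ) (u : Word (n + 1) D) : Prop :=
  ∃ h : 1 ≤ p ∧ p + 2 ≤ q ∧ q + 2 ≤ r ∧ r ≤ n,
    u ⟨p, by omega⟩ = u 0 ∧ u ⟨q, by omega⟩ = revIdx (u 0) ∧ u ⟨r, by omega⟩ = u 0 ∧
      ∀ i : Fin (n + 1), i.val ≠ 0 → i.val ≠ p → i.val ≠ q → i.val ≠ r → (u i).1 ≠ (u 0).1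

/-- The copies of `f` in a skeleton word are exactly at `0, p, r`. [cite: MadrasSlade1993, §4.2 (p. 94); lane plumbing] -/
theorem IsSkel.eq_first_iff {p q r : ℕ} {u : Word (n + 1) D} (h : IsSkel p q r u) (i : Fin (n + 1)) :
    u i = u 0 ↔ i.val = 0 ∨ i.val = p ∨ i.val = r := by
  obtain ⟨hadm, hp, hq, hr, hoff⟩ := h
  constructor
  · intro hi
    by_contra hne
    push Not at hne
    by_cases hiq : i.val = q
    · have : i = ⟨q, by omega⟩ := Fin.ext hiq
      rw [this, hq] at hi
      exact revIdx_ne_self _ hi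
    · exact hoff i hne.1 hne.2.1 hiq hne.2.2 (by rw [hi])
  · rintro (h0 | hp' | hr')
    · rw [show i = 0 from Fin.ext h0]
    · rw [show i = ⟨p, by omega⟩ from Fin.ext hp', hp]
    · rw [show i = ⟨r, by omega⟩ from Fin.ext hr', hr]

/-- The reverse of `f` in a skeleton word is exactly at `q`. [cite: MadrasSlade1993, §4.2 (p. 94); lane plumbing] -/
theorem IsSkel.eq_rev_iff {p q r : ℕ} {u : Word (n + 1) D} (h : IsSkel p q r u) (i : Fin (n + 1)) :
    u i = revIdx (u 0) ↔ i.val = q := by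
  obtain ⟨hadm, hp, hq, hr, hoff⟩ := h
  constructor
  · intro hi
    by_contra hiq
    by_cases h0 : i.val = 0
    · rw [show i = 0 from Fin.ext h0] at hi
      exact revIdx_ne_self _ hi.symm
    by_cases hip : i.val = p
    · rw [show i = ⟨p, by omega⟩ from Fin.ext hip, hp] at hi
      exact revIdx_ne_self _ hi.symm
    by_cases hir : i.val = r
    · rw [show i = ⟨r, by omega⟩ from Fin.ext hir, hr] at hi
      exact revIdx_ne_self _ hi.symm
    exact hoff i h0 hip hiq hir (by rw [hi]; rfl)
  · intro hiq
    rw [show i = ⟨q, by omega⟩ from Fin.ext hiq, hq]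

/-- The vertical signs of a skeleton word. [cite: MadrasSlade1993, §4.2 (p. 94); lane plumbing] -/
theorem IsSkel.vs_apply {p q r : ℕ} {u : Word (n + 1) D} (h : IsSkel p q r u) (i : ℕ) (hi : i < n + 1) :
    vs (u 0) (u ⟨i, hi⟩) = if i = 0 ∨ i = p ∨ i = r then 1 else if i = q then -1 else 0 := by
  by_cases h1 : i = 0 ∨ i = p ∨ i = r
  · rw [if_pos h1, (h.eq_first_iff ⟨i, hi⟩).2 h1, vs_self]
  · rw [if_neg h1]
    by_cases h2 : i = q
    · rw [if_pos h2, (h.eq_rev_iff ⟨i, hi⟩).2 h2, vs_revIdx]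
    · rw [if_neg h2]
      obtain ⟨hadm, -, -, -, hoff⟩ := h
      push Not at h1
      exact vs_of_fst_ne _ _ (hoff ⟨i, hi⟩ h1.1 h1.2.1 h2 h1.2.2)

/-- ★ The heights of a skeleton word: `Hgt u i = [0<i] + [p<i] − [q<i] + [r<i]`. [cite: MadrasSlade1993, §4.2 (p. 94); lane lemma] -/
theorem IsSkel.hgt_eq {p q r : ℕ} {u : Word (n + 1) D} (h : IsSkel p q r u) (i : ℕ) (hi : i ≤ n + 1) :
    Hgt u i = (if 0 < i then 1 else 0) + (if p < i then 1 else 0) - (if q < i then 1 else 0) + (if r < i then 1 else 0) := by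
  obtain ⟨hadm, -⟩ := id h
  induction i with
  | zero => simp [hgt_zero]
  | succ i ih =>
    rw [hgt_succ u (by omega), ih (by omega), h.vs_apply]
    split_ifs <;> omega

/-- The heights of a skeleton word lie in `{1, 2}` after time `0`, and the final height is `2`. [cite: MadrasSlade1993, §4.2 (p. 94); lane plumbing] -/
theorem IsSkel.hgt_bounds {p q r : ℕ} {u : Word (n + 1) D} (h : IsSkel p q r u) (i : ℕ) (hi1 : 1 ≤ i) (hi : i ≤ n + 1) :
    1 ≤ Hgt u i ∧ Hgt u i ≤ 2 := by
  obtain ⟨hadm, -⟩ := id h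
  rw [h.hgt_eq i hi]
  split_ifs <;> omega

/-- The final height of a skeleton word is `2`. [cite: MadrasSlade1993, §4.2 (p. 94); lane plumbing] -/
theorem IsSkel.hgt_last {p q r : ℕ} {u : Word (n + 1) D} (h : IsSkel p q r u) : Hgt u (n + 1) = 2 := by
  obtain ⟨hadm, -⟩ := id h
  rw [h.hgt_eq (n + 1) le_rfl]
  split_ifs <;> omega

/-- ★ A SKELETON WORD IS AN IRREDUCIBLE BRIDGE along the axis of its first letter (heights `1, 2` only; the down step at `q` kills every
renewal time). [cite: MadrasSlade1993, §4.2 (p. 94); Definition 1.2.4; lane lemma] -/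
theorem IsSkel.isIrrH {p q r : ℕ} {u : Word (n + 1) D} (h : IsSkel p q r u) : IsIrrH (n + 1) (Hgt u) := by
  obtain ⟨hadm, -⟩ := id h
  refine ⟨by omega, fun i hi1 hi => ?_, fun k hk1 hk hren => ?_⟩
  · rw [hgt_zero, h.hgt_last]
    have := h.hgt_bounds i hi1 hi
    omega
  · obtain ⟨-, hb1, hb2⟩ := hren
    -- the first piece forces `Hgt u k ≥ 2` once `k > p`... and the second piece forces every later height `> Hgt u k`
    have hk' : k ≤ n := by omega
    by_cases hkq : k ≤ q
    · -- the second piece contains the down step: height at `q + 1` is `Hgt u k − …`; concretely `Hgt u (q+1) ≤ Hgt u k`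
      have h2 := (hb2 (q + 1 - k) (by omega) (by omega)).1
      simp only at h2
      rw [show k + (q + 1 - k) = q + 1 by omega, show k + 0 = k by rfl] at h2
      rw [h.hgt_eq (q + 1) (by omega), h.hgt_eq k (by omega)] at h2
      split_ifs at h2 <;> omega
    · -- `k > q`: the first piece reached height `2` at `p + 1 ≤ k` but `Hgt u k`… first piece needs `Hgt u (p+1) ≤ Hgt u k`
      -- and the second piece needs `Hgt u k < Hgt u (n+1) = 2`
      have h2 := (hb2 (n + 1 - k) (by omega) (by omega)).1
      simp only at h2
      rw [show k + (n + 1 - k) = n + 1 by omega, show k + 0 = k by rfl, h.hgt_last, h.hgt_eq k (by omega)] at h2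
      have h1 := (hb1 (p + 1) (by omega) (by omega)).2
      rw [h.hgt_eq (p + 1) (by omega), h.hgt_eq k (by omega)] at h1
      split_ifs at h1 h2 <;> omega

/-! ### Rigidity: a bridge word of cost `c`, length `c + 2` and at least `c − 2` axes is a skeleton word -/

/-- A letter on the axis of `f` is `f` or `f̄`. [cite: MadrasSlade1993, Definition 1.2.4; lane plumbing] -/
theorem eq_or_eq_revIdx_of_fst_eq {a f : Idx D} (h : a.1 = f.1) : a = f ∨ a = revIdx f := by
  obtain ⟨x, s⟩ := a
  obtain ⟨y, t⟩ := f
  simp only at h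
  subst h
  by_cases hst : s = t
  · left; rw [hst]
  · right; rw [revIdx_eq]; simp only [Prod.mk.injEq, true_and]; cases s <;> cases t <;> simp_all

/-- Heights from the positions of the vertical letters (general form used by the rigidity argument).
[cite: MadrasSlade1993, §4.2 (p. 94); lane plumbing] -/
theorem hgt_eq_of_vertical (u : Word (n + 1) D) (P M : ℕ → Prop) [DecidablePred P] [DecidablePred M]
    (hP : ∀ i : ℕ, ∀ hi : i < n + 1, u ⟨i, hi⟩ = u 0 ↔ P i) (hM : ∀ i : ℕ, ∀ hi : i < n + 1, u ⟨i, hi⟩ = revIdx (u 0) ↔ M i)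
    (i : ℕ) (hi : i ≤ n + 1) :
    Hgt u i = (((Finset.range i).filter P).card : ℤ) - ((Finset.range i).filter M).card := by
  induction i with
  | zero => simp [hgt_zero]
  | succ i ih =>
    rw [hgt_succ u (by omega), ih (by omega), Finset.range_add_one, Finset.filter_insert, Finset.filter_insert]
    have hvs : vs (u 0) (u ⟨i, by omega⟩) = (if P i then 1 else 0) - (if M i then 1 else 0) := by
      by_cases h1 : P i
      · rw [if_pos h1, (hP i (by omega)).2 h1, vs_self]
        by_cases h2 : M i
        · exact absurd (((hP i (by omega)).2 h1).symm.trans ((hM i (by omega)).2 h2)) (revIdx_ne_self _).symm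
        · rw [if_neg h2]; ring
      · rw [if_neg h1]
        by_cases h2 : M i
        · rw [if_pos h2, (hM i (by omega)).2 h2, vs_revIdx]; ring
        · rw [if_neg h2]
          have hax : (u ⟨i, by omega⟩).1 ≠ (u 0).1 := by
            intro hax
            rcases eq_or_eq_revIdx_of_fst_eq hax with e | e
            · exact h1 ((hP i (by omega)).1 e)
            · exact h2 ((hM i (by omega)).1 e)
          rw [vs_of_fst_ne _ _ hax]; ring
    rw [hvs]
    have hnot : i ∉ Finset.range i := by simp
    by_cases h1 : P i <;> by_cases h2 : M i <;>
      simp [h1, h2, Finset.card_insert_of_notMem, hnot] <;> ring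

/-- With `V⁺` the positions of `f = u 0` and `V⁻` those of `f̄`: `numAxes u + |V⁺| + |V⁻| ≤ n + 2` (every vertical position but `0` is
non-first). [cite: MadrasSlade1993, §4.2 (p. 94); lane lemma] -/
theorem numAxes_add_card_vertical_le (u : Word (n + 1) D) :
    numAxes u + (Finset.univ.filter fun i : Fin (n + 1) => u i = u 0).card +
        (Finset.univ.filter fun i : Fin (n + 1) => u i = revIdx (u 0)).card ≤ n + 2 := by
  classical
  set V : Finset (Fin (n + 1)) := (Finset.univ.filter fun i : Fin (n + 1) => u i = u 0 ∨ u i = revIdx (u 0)).erase 0 with hV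
  have hle := numAxes_add_card_le u V fun i hi => by
    obtain ⟨hi0, hi'⟩ := Finset.mem_erase.1 hi
    have hax : (u 0).1 = (u i).1 := by
      rcases (Finset.mem_filter.1 hi').2 with e | e
      · rw [e]
      · rw [e]; rfl
    exact not_isFirst_of_axis_eq u (q := 0) (Fin.pos_iff_ne_zero.2 hi0) hax
  have hdisj : Disjoint (Finset.univ.filter fun i : Fin (n + 1) => u i = u 0)
      (Finset.univ.filter fun i : Fin (n + 1) => u i = revIdx (u 0)) := by
    rw [Finset.disjoint_filter]
    intro i _ h1 h2
    exact revIdx_ne_self _ (h1.symm.trans h2).symm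
  have hunion : (Finset.univ.filter fun i : Fin (n + 1) => u i = u 0 ∨ u i = revIdx (u 0)) =
      (Finset.univ.filter fun i : Fin (n + 1) => u i = u 0) ∪ (Finset.univ.filter fun i : Fin (n + 1) => u i = revIdx (u 0)) :=
    Finset.filter_or _ _ _
  have h0mem : (0 : Fin (n + 1)) ∈ Finset.univ.filter fun i : Fin (n + 1) => u i = u 0 ∨ u i = revIdx (u 0) := by simp
  have hcardV : V.card + 1 = (Finset.univ.filter fun i : Fin (n + 1) => u i = u 0).card +
      (Finset.univ.filter fun i : Fin (n + 1) => u i = revIdx (u 0)).card := by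
    rw [hV, Finset.card_erase_add_one h0mem, hunion, Finset.card_union_of_disjoint hdisj]
  omega

/-- The vertical sign as a difference of indicators. [cite: MadrasSlade1993, Definition 1.2.4; lane plumbing] -/
theorem vs_eq_ite_sub_ite (f a : Idx D) : vs f a = (if a = f then (1 : ℤ) else 0) - (if a = revIdx f then 1 else 0) := by
  by_cases h1 : a = f
  · subst h1
    rw [vs_self, if_pos rfl, if_neg (fun h => revIdx_ne_self a h.symm)]; ring
  · rw [if_neg h1]
    by_cases h2 : a = revIdx f
    · rw [if_pos h2, h2, vs_revIdx]; ring
    · rw [if_neg h2]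
      have hax : a.1 ≠ f.1 := fun h => by
        rcases eq_or_eq_revIdx_of_fst_eq h with e | e
        · exact h1 e
        · exact h2 e
      rw [vs_of_fst_ne _ _ hax]; ring

/-- The final height is `|V⁺| − |V⁻|`. [cite: MadrasSlade1993, §4.2 (p. 94); lane plumbing] -/
theorem hgt_last_eq_card_sub_card (u : Word (n + 1) D) :
    Hgt u (n + 1) = (((Finset.univ.filter fun i : Fin (n + 1) => u i = u 0).card : ℕ) : ℤ) -
      ((Finset.univ.filter fun i : Fin (n + 1) => u i = revIdx (u 0)).card : ℕ) := by
  classical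
  unfold Hgt
  rw [Finset.sum_congr rfl fun p _ => vs_eq_ite_sub_ite (u 0) (u p), Finset.sum_sub_distrib, Finset.sum_boole, Finset.sum_boole,
    Finset.filter_filter, Finset.filter_filter]
  have e1 : (Finset.univ.filter fun a : Fin (n + 1) => a.val < n + 1 ∧ u a = u 0) = Finset.univ.filter fun i => u i = u 0 :=
    Finset.filter_congr fun a _ => by simp [a.2]
  have e2 : (Finset.univ.filter fun a : Fin (n + 1) => a.val < n + 1 ∧ u a = revIdx (u 0)) =
      Finset.univ.filter fun i => u i = revIdx (u 0) := Finset.filter_congr fun a _ => by simp [a.2]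
  rw [e1, e2]

/-- Count of `{j < i : j = t}`. [cite: MadrasSlade1993, §4.2 (p. 94); lane plumbing] -/
theorem card_range_filter_eq (i t : ℕ) : ((Finset.range i).filter fun j => j = t).card = if t < i then 1 else 0 := by
  rw [Finset.filter_eq' (Finset.range i) t]
  simp only [Finset.mem_range]
  split_ifs <;> simp

/-- ★★ RIGIDITY OF THE SPAN-TWO CELL DOWN TO THE SECOND CLASS: a word of length `c + 2` (`= n + 1`) in the bridge class of cost `c` with at
least `c − 2` axes is a skeleton word `f … f … f̄ … f` (admissible `p, q, r`). [cite: MadrasSlade1993, §4.2 (p. 94: cost = length − span; down steps); lane theorem] -/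
theorem exists_isSkel_of_qb {c : ℕ} {u : Word (n + 1) D} (hn : n = c + 1) (hq : QB c u) (hax : c ≤ numAxes u + 2) :
    ∃ p q r, IsSkel p q r u := by
  classical
  obtain ⟨hsaw, hirr, hcost⟩ := hq
  obtain ⟨-, hbr, hnoren⟩ := hirr
  set Vp := Finset.univ.filter fun i : Fin (n + 1) => u i = u 0 with hVp
  set Vm := Finset.univ.filter fun i : Fin (n + 1) => u i = revIdx (u 0) with hVm
  have hcount := numAxes_add_card_vertical_le u
  have hlast := hgt_last_eq_card_sub_card u
  rw [← hVp, ← hVm] at hcount hlast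
  have h0val : ((0 : Fin (n + 1)) : ℕ) = 0 := rfl
  -- the final height is 2 (cost `c` = length − span)
  have hpos : 0 < Hgt u (n + 1) := by
    have := (hbr (n + 1) (by omega) le_rfl).1
    rwa [hgt_zero] at this
  have hspan : Hgt u (n + 1) = 2 := by
    have ht : ((Hgt u (n + 1)).toNat : ℤ) = Hgt u (n + 1) := Int.toNat_of_nonneg hpos.le
    have : Vp.card ≤ n + 1 := (Finset.card_le_univ _).trans (by simp)
    omega
  have h0 : (0 : Fin (n + 1)) ∈ Vp := by simp [hVp]
  have hsum : Vp.card + Vm.card ≤ 4 := by omega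
  have hdiff : (Vp.card : ℤ) = Vm.card + 2 := by rw [← hspan, hlast]; ring
  -- self-avoidance forbids immediate reversals
  have hnorev : ∀ i : ℕ, ∀ hi : i + 1 < n + 1, u ⟨i + 1, hi⟩ ≠ revIdx (u ⟨i, by omega⟩) := by
    intro i hi e
    have heq : wordPos u (i + 2) = wordPos u i := by
      rw [wordPos_succ u (show i + 1 < n + 1 by omega), wordPos_succ u (show i < n + 1 by omega), add_assoc,
        (stepVec_add_eq_zero_iff_eq_rev _ _).2 e, add_zero]
    have := hsaw i (i + 2) (by omega) (by omega) heq.symm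
    omega
  -- membership in `Vp`, `Vm` as statements about letters
  have memVp : ∀ (i : ℕ) (hi : i < n + 1), (⟨i, hi⟩ : Fin (n + 1)) ∈ Vp ↔ u ⟨i, hi⟩ = u 0 := fun i hi => by simp [hVp]
  have memVm : ∀ (i : ℕ) (hi : i < n + 1), (⟨i, hi⟩ : Fin (n + 1)) ∈ Vm ↔ u ⟨i, hi⟩ = revIdx (u 0) := fun i hi => by simp [hVm]
  rcases Nat.eq_zero_or_pos Vm.card with hm0 | hmpos
  · -- no down step: `V⁺ = {0, p}` and `p` is a renewal time
    exfalso
    have hp2 : Vp.card = 2 := by omega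
    have hcard1 : (Vp.erase 0).card = 1 := by rw [Finset.card_erase_of_mem h0, hp2]
    obtain ⟨pp, hVe⟩ := Finset.card_eq_one.1 hcard1
    have hVpeq : Vp = {0, pp} := by rw [← Finset.insert_erase h0, hVe]
    have hpp0 : pp ≠ 0 := fun e => by
      have : pp ∈ Vp.erase 0 := by rw [hVe]; exact Finset.mem_singleton_self _
      rw [e] at this; exact Finset.notMem_erase 0 Vp this
    set p := pp.val with hpdef
    have hpv : p < n + 1 := pp.2
    have hp1 : 1 ≤ p := Nat.pos_of_ne_zero fun e => hpp0 (Fin.ext e)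
    have hP : ∀ i : ℕ, ∀ hi : i < n + 1, u ⟨i, hi⟩ = u 0 ↔ (i = 0 ∨ i = p) := by
      intro i hi
      rw [← memVp i hi, hVpeq, Finset.mem_insert, Finset.mem_singleton, Fin.ext_iff, Fin.ext_iff, h0val]
    have hM : ∀ i : ℕ, ∀ hi : i < n + 1, u ⟨i, hi⟩ = revIdx (u 0) ↔ False := by
      intro i hi
      rw [← memVm i hi, Finset.card_eq_zero.1 hm0]
      simp
    have hH : ∀ i, i ≤ n + 1 → Hgt u i = (if 0 < i then 1 else 0) + (if p < i then 1 else 0) := by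
      intro i hi
      rw [hgt_eq_of_vertical u (fun i => i = 0 ∨ i = p) (fun _ => False) hP hM i hi, Finset.filter_false, Finset.card_empty,
        Nat.cast_zero, sub_zero, Finset.filter_or,
        Finset.card_union_of_disjoint (by rw [Finset.disjoint_filter]; intro j _ hj0 hjp; omega),
        card_range_filter_eq, card_range_filter_eq]
      push_cast; ring
    refine hnoren p hp1 (by omega) ⟨by omega, fun i hi1 hi => ?_, fun j hj1 hj => ?_⟩
    · rw [hgt_zero, hH i (by omega), hH p (by omega)]
      split_ifs <;> omega
    · simp only
      rw [hH (p + j) (by omega), show p + 0 = p by omega, hH p (by omega), show p + (n + 1 - p) = n + 1 by omega,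
        hH (n + 1) le_rfl]
      split_ifs <;> omega
  · -- one down step at `q`, two further up steps at `p < r`
    have hm1 : Vm.card = 1 := by omega
    have hp3 : Vp.card = 3 := by omega
    obtain ⟨qq, hVmeq⟩ := Finset.card_eq_one.1 hm1
    have hqq0 : qq ≠ 0 := by
      intro e
      have : (0 : Fin (n + 1)) ∈ Vm := by rw [hVmeq, e]; exact Finset.mem_singleton_self _
      exact revIdx_ne_self _ ((Finset.mem_filter.1 this).2).symm
    have hcard2 : (Vp.erase 0).card = 2 := by rw [Finset.card_erase_of_mem h0, hp3]
    obtain ⟨a, b, hab, hVe⟩ := Finset.card_eq_two.1 hcard2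
    have ha0 : a ≠ 0 := fun e => by
      have : a ∈ Vp.erase 0 := by rw [hVe]; simp
      rw [e] at this; exact Finset.notMem_erase 0 Vp this
    have hb0 : b ≠ 0 := fun e => by
      have : b ∈ Vp.erase 0 := by rw [hVe]; simp
      rw [e] at this; exact Finset.notMem_erase 0 Vp this
    have hVpeq : Vp = {0, a, b} := by rw [← Finset.insert_erase h0, hVe]
    set q := qq.val with hqdef
    have hqv : q < n + 1 := qq.2
    have hq1 : 1 ≤ q := Nat.pos_of_ne_zero fun e => hqq0 (Fin.ext e)
    have hM : ∀ i : ℕ, ∀ hi : i < n + 1, u ⟨i, hi⟩ = revIdx (u 0) ↔ i = q := by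
      intro i hi
      rw [← memVm i hi, hVmeq, Finset.mem_singleton, Fin.ext_iff]
    -- WLOG `a < b`
    have key : ∀ p r : ℕ, 1 ≤ p → 1 ≤ r → p < r → r < n + 1 →
        (∀ i : ℕ, ∀ hi : i < n + 1, u ⟨i, hi⟩ = u 0 ↔ (i = 0 ∨ i = p ∨ i = r)) → ∃ p q r, IsSkel p q r u := by
      intro p r hp1 hr1 hpr hrv hP
      have hpv : p < n + 1 := by omega
      have hH : ∀ i, i ≤ n + 1 → Hgt u i = (if 0 < i then 1 else 0) + (if p < i then 1 else 0) +
          (if r < i then 1 else 0) - (if q < i then 1 else 0) := by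
        intro i hi
        rw [hgt_eq_of_vertical u (fun i => i = 0 ∨ i = p ∨ i = r) (fun i => i = q) hP hM i hi, Finset.filter_or,
          Finset.card_union_of_disjoint (by rw [Finset.disjoint_filter]; intro j _ hj0 hj; rcases hj with hj | hj <;> omega),
          Finset.filter_or, Finset.card_union_of_disjoint (by rw [Finset.disjoint_filter]; intro j _ hj1 hj2; omega),
          card_range_filter_eq, card_range_filter_eq, card_range_filter_eq, card_range_filter_eq]
        push_cast; ring
      -- `p < q < r` from the bridge bounds
      have hqp : q ≠ p := fun e => by
        have h1 := (hP q hqv).2 (Or.inr (Or.inl e)); have h2 := (hM q hqv).2 rfl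
        exact revIdx_ne_self _ (h1.symm.trans h2).symm
      have hqr' : q ≠ r := fun e => by
        have h1 := (hP q hqv).2 (Or.inr (Or.inr e)); have h2 := (hM q hqv).2 rfl
        exact revIdx_ne_self _ (h1.symm.trans h2).symm
      have hpq : p < q := by
        by_contra hle
        have := (hbr (q + 1) (by omega) (by omega)).1
        rw [hgt_zero, hH (q + 1) (by omega)] at this
        split_ifs at this <;> omega
      have hqr : q < r := by
        by_contra hle
        have := (hbr (r + 1) (by omega) (by omega)).2
        rw [hH (r + 1) (by omega), hH (n + 1) le_rfl] at this
        split_ifs at this <;> omega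
      -- non-adjacency from self-avoidance
      have hqp1 : q ≠ p + 1 := by
        intro e
        have h1 := (hM q hqv).2 rfl
        have h2 := (hP p hpv).2 (Or.inr (Or.inl rfl))
        refine hnorev p (by omega) ?_
        rw [show (⟨p + 1, _⟩ : Fin (n + 1)) = ⟨q, hqv⟩ from Fin.ext e.symm, h1, h2]
      have hrq1 : r ≠ q + 1 := by
        intro e
        have h1 := (hP r hrv).2 (Or.inr (Or.inr rfl))
        have h2 := (hM q hqv).2 rfl
        refine hnorev q (by omega) ?_
        rw [show (⟨q + 1, _⟩ : Fin (n + 1)) = ⟨r, hrv⟩ from Fin.ext e.symm, h1, h2, revIdx_revIdx]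
      refine ⟨p, q, r, ⟨hp1, by omega, by omega, by omega⟩, (hP p hpv).2 (Or.inr (Or.inl rfl)), (hM q hqv).2 rfl,
        (hP r hrv).2 (Or.inr (Or.inr rfl)), fun i hi0 hip hiq hir hax' => ?_⟩
      rcases eq_or_eq_revIdx_of_fst_eq hax' with e | e
      · rcases (hP i.val i.2).1 e with h' | h' | h'
        · exact hi0 h'
        · exact hip h'
        · exact hir h'
      · exact hiq ((hM i.val i.2).1 e)
    have ha1 : 1 ≤ a.val := Nat.pos_of_ne_zero fun e => ha0 (Fin.ext e)
    have hb1 : 1 ≤ b.val := Nat.pos_of_ne_zero fun e => hb0 (Fin.ext e)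
    have habv : a.val ≠ b.val := fun e => hab (Fin.ext e)
    rcases lt_or_gt_of_ne habv with hlt | hgt
    · refine key a.val b.val ha1 hb1 hlt b.2 fun i hi => ?_
      rw [← memVp i hi, hVpeq, Finset.mem_insert, Finset.mem_insert, Finset.mem_singleton, Fin.ext_iff, Fin.ext_iff, Fin.ext_iff,
        h0val]
    · refine key b.val a.val hb1 ha1 hgt a.2 fun i hi => ?_
      rw [← memVp i hi, hVpeq, Finset.mem_insert, Finset.mem_insert, Finset.mem_singleton, Fin.ext_iff, Fin.ext_iff, Fin.ext_iff,
        h0val]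
      tauto

/-- Consequently a bridge-class word of cost `c` and length `c + 2` has at most `c − 1` axes. [cite: MadrasSlade1993, §4.2 (p. 94); lane lemma] -/
theorem numAxes_le_of_qb {c : ℕ} {u : Word (n + 1) D} (hn : n = c + 1) (hq : QB c u) : numAxes u + 2 ≤ n := by
  by_contra hlt
  obtain ⟨p, q, r, hsk⟩ := exists_isSkel_of_qb hn hq (by omega)
  obtain ⟨hadm, hp, hq', hr, -⟩ := hsk
  have hle := numAxes_add_card_vertical_le u
  -- `V⁺ ⊇ {0, p, r}` and `V⁻ ⊇ {q}`
  have h3 : 3 ≤ (Finset.univ.filter fun i : Fin (n + 1) => u i = u 0).card := by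
    have hsub : ({(0 : Fin (n + 1)), ⟨p, by omega⟩, ⟨r, by omega⟩} : Finset (Fin (n + 1))) ⊆
        Finset.univ.filter fun i : Fin (n + 1) => u i = u 0 := by
      intro i hi
      simp only [Finset.mem_insert, Finset.mem_singleton] at hi
      rcases hi with rfl | rfl | rfl <;> simp [hp, hr]
    refine le_trans (le_of_eq ?_) (Finset.card_le_card hsub)
    rw [Finset.card_insert_of_notMem (by simp [Fin.ext_iff]; omega), Finset.card_insert_of_notMem (by simp [Fin.ext_iff]; omega),
      Finset.card_singleton]
  have h1 : 1 ≤ (Finset.univ.filter fun i : Fin (n + 1) => u i = revIdx (u 0)).card :=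
    Finset.card_pos.2 ⟨⟨q, by omega⟩, by simp [hq']⟩
  omega

/-! ### The local exclusions: adjacent lateral reversals and the four vertical unit squares -/

/-- `LocalOK p q r u`: no immediate reversal between ADJACENT lateral letters, and none of the four vertical unit squares
`b U₂ b̄ D`, `U₂ b D b̄`, `b D b̄ U₃`, `D b U₃ b̄` (each a reversed pair of lateral letters around two consecutive vertical steps two apart).
[cite: MadrasSlade1993, §1.1 (p. 3: unit squares); lane tool notion] -/
def LocalOK (p q r : ℕ) (u : Word (n + 1) D) : Prop :=
  (∀ i : ℕ, ∀ hi : i + 1 < n + 1, i ≠ 0 → i ≠ p → i ≠ q → i ≠ r → i + 1 ≠ p → i + 1 ≠ q → i + 1 ≠ r →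
      u ⟨i + 1, hi⟩ ≠ revIdx (u ⟨i, by omega⟩)) ∧
    (∀ hq : q = p + 2, ∀ hp : 2 ≤ p, ∀ h : p + 1 < n + 1, u ⟨p + 1, h⟩ ≠ revIdx (u ⟨p - 1, by omega⟩)) ∧
    (∀ hq : q = p + 2, ∀ h : q + 1 < n + 1, u ⟨q + 1, h⟩ ≠ revIdx (u ⟨p + 1, by omega⟩)) ∧
    (∀ hr : r = q + 2, ∀ h : q + 1 < n + 1, ∀ h' : 1 ≤ q, u ⟨q + 1, h⟩ ≠ revIdx (u ⟨q - 1, by omega⟩)) ∧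
    (∀ hr : r = q + 2, ∀ h : r + 1 < n + 1, u ⟨r + 1, h⟩ ≠ revIdx (u ⟨q + 1, by omega⟩))

/-- A zero block of four consecutive letters `a, b, ā, b̄`-type: if `u (i+2) = rev (u i)` and `u (i+3) = rev (u (i+1))` then
`wordPos i = wordPos (i+4)`. [cite: MadrasSlade1993, §1.1 (p. 3); lane plumbing] -/
theorem wordPos_eq_add_four_of_rev (u : Word (n + 1) D) {i : ℕ} (hi : i + 4 ≤ n + 1)
    (h1 : u ⟨i + 2, by omega⟩ = revIdx (u ⟨i, by omega⟩)) (h2 : u ⟨i + 3, by omega⟩ = revIdx (u ⟨i + 1, by omega⟩)) :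
    wordPos u i = wordPos u (i + 4) := by
  have s0 : wordPos u (i + 1) = wordPos u i + stepVec (u ⟨i, by omega⟩) := wordPos_succ u (show i < n + 1 by omega)
  have s1 : wordPos u (i + 2) = wordPos u (i + 1) + stepVec (u ⟨i + 1, by omega⟩) := wordPos_succ u (show i + 1 < n + 1 by omega)
  have s2 : wordPos u (i + 3) = wordPos u (i + 2) + stepVec (u ⟨i + 2, by omega⟩) := wordPos_succ u (show i + 2 < n + 1 by omega)
  have s3 : wordPos u (i + 4) = wordPos u (i + 3) + stepVec (u ⟨i + 3, by omega⟩) := wordPos_succ u (show i + 3 < n + 1 by omega)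
  have e1 : stepVec (u ⟨i, by omega⟩) + stepVec (u ⟨i + 2, by omega⟩) = 0 := (stepVec_add_eq_zero_iff_eq_rev _ _).2 h1
  have e2 : stepVec (u ⟨i + 1, by omega⟩) + stepVec (u ⟨i + 3, by omega⟩) = 0 := (stepVec_add_eq_zero_iff_eq_rev _ _).2 h2
  have : wordPos u (i + 4) = wordPos u i + (stepVec (u ⟨i, by omega⟩) + stepVec (u ⟨i + 2, by omega⟩)) +
      (stepVec (u ⟨i + 1, by omega⟩) + stepVec (u ⟨i + 3, by omega⟩)) := by
    rw [s3, s2, s1, s0]; abel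
  rw [this, e1, e2, add_zero, add_zero]

/-- ★ SELF-AVOIDANCE FORCES THE LOCAL EXCLUSIONS (each violation is a zero block of length 2 or 4).
[cite: MadrasSlade1993, §1.1 (p. 3); lane lemma] -/
theorem localOK_of_isSAW {p q r : ℕ} {u : Word (n + 1) D} (hsk : IsSkel p q r u) (hsaw : Percolation.IsSAW u) : LocalOK p q r u := by
  obtain ⟨hadm, hp, hq, hr, -⟩ := hsk
  have two : ∀ i : ℕ, ∀ hi : i + 1 < n + 1, u ⟨i + 1, hi⟩ ≠ revIdx (u ⟨i, by omega⟩) := by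
    intro i hi e
    have heq : wordPos u (i + 2) = wordPos u i := by
      rw [wordPos_succ u (show i + 1 < n + 1 by omega), wordPos_succ u (show i < n + 1 by omega), add_assoc,
        (stepVec_add_eq_zero_iff_eq_rev _ _).2 e, add_zero]
    have := hsaw i (i + 2) (by omega) (by omega) heq.symm
    omega
  have four : ∀ i : ℕ, ∀ hi : i + 4 ≤ n + 1, u ⟨i + 2, by omega⟩ = revIdx (u ⟨i, by omega⟩) →
      u ⟨i + 3, by omega⟩ = revIdx (u ⟨i + 1, by omega⟩) → False := by
    intro i hi h1 h2
    have := hsaw i (i + 4) (by omega) (by omega) (wordPos_eq_add_four_of_rev u hi h1 h2)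
    omega
  refine ⟨fun i hi _ _ _ _ _ _ _ => two i hi, fun hqp hp2 h e => ?_, fun hqp h e => ?_, fun hrq h h1 e => ?_, fun hrq h e => ?_⟩
  · -- `b U₂ b̄ D`: block `[p−1, p+3)`
    refine four (p - 1) (by omega) ?_ ?_
    · rw [apply_mk_congr u (show p - 1 + 2 = p + 1 by omega)]; exact e
    · rw [apply_mk_congr u (show p - 1 + 3 = q by omega), apply_mk_congr u (show p - 1 + 1 = p by omega), hq, hp]
  · -- `U₂ b D b̄`: block `[p, p+4)`
    refine four p (by omega) ?_ ?_
    · rw [apply_mk_congr u (show p + 2 = q by omega), hq, hp]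
    · rw [apply_mk_congr u (show p + 3 = q + 1 by omega)]; exact e
  · -- `b D b̄ U₃`: block `[q−1, q+3)`
    refine four (q - 1) (by omega) ?_ ?_
    · rw [apply_mk_congr u (show q - 1 + 2 = q + 1 by omega)]; exact e
    · rw [apply_mk_congr u (show q - 1 + 3 = r by omega), apply_mk_congr u (show q - 1 + 1 = q by omega), hr, hq, revIdx_revIdx]
  · -- `D b U₃ b̄`: block `[q, q+4)`
    refine four q (by omega) ?_ ?_
    · rw [apply_mk_congr u (show q + 2 = r by omega), hr, hq, revIdx_revIdx]
    · rw [apply_mk_congr u (show q + 3 = r + 1 by omega)]; exact e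

/-! ### The converse: the local exclusions and at most one lateral axis coincidence make a skeleton word self-avoiding -/

/-- Five pairwise distinct non-first positions are too many when `numAxes u + 4 ≥ n + 1`. [cite: MadrasSlade1993, Definition 1.2.4; lane lemma] -/
theorem false_of_five_nonFirst {u : Word (n + 1) D} (hnum : n ≤ numAxes u + 3) (p₁ p₂ p₃ p₄ p₅ : ℕ) (h₁ : p₁ < n + 1) (h₂ : p₂ < n + 1)
    (h₃ : p₃ < n + 1) (h₄ : p₄ < n + 1) (h₅ : p₅ < n + 1)
    (hd : p₁ ≠ p₂ ∧ p₁ ≠ p₃ ∧ p₁ ≠ p₄ ∧ p₁ ≠ p₅ ∧ p₂ ≠ p₃ ∧ p₂ ≠ p₄ ∧ p₂ ≠ p₅ ∧ p₃ ≠ p₄ ∧ p₃ ≠ p₅ ∧ p₄ ≠ p₅)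
    (n₁ : ¬ IsFirst u ⟨p₁, h₁⟩) (n₂ : ¬ IsFirst u ⟨p₂, h₂⟩) (n₃ : ¬ IsFirst u ⟨p₃, h₃⟩) (n₄ : ¬ IsFirst u ⟨p₄, h₄⟩)
    (n₅ : ¬ IsFirst u ⟨p₅, h₅⟩) : False := by
  classical
  have hle := numAxes_add_card_le u {⟨p₁, h₁⟩, ⟨p₂, h₂⟩, ⟨p₃, h₃⟩, ⟨p₄, h₄⟩, ⟨p₅, h₅⟩} (by
    intro p hp
    simp only [Finset.mem_insert, Finset.mem_singleton] at hp
    rcases hp with rfl | rfl | rfl | rfl | rfl <;> assumption)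
  have hcard : ({⟨p₁, h₁⟩, ⟨p₂, h₂⟩, ⟨p₃, h₃⟩, ⟨p₄, h₄⟩, ⟨p₅, h₅⟩} : Finset (Fin (n + 1))).card = 5 := by
    obtain ⟨d12, d13, d14, d15, d23, d24, d25, d34, d35, d45⟩ := hd
    rw [Finset.card_insert_of_notMem (by simp [Fin.ext_iff]; omega), Finset.card_insert_of_notMem (by simp [Fin.ext_iff]; omega),
      Finset.card_insert_of_notMem (by simp [Fin.ext_iff]; omega), Finset.card_insert_of_notMem (by simp [Fin.ext_iff]; omega),
      Finset.card_singleton]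
  omega

/-- The three vertical positions `p, q, r` of a skeleton word are non-first. [cite: MadrasSlade1993, §4.2 (p. 94); lane plumbing] -/
theorem IsSkel.not_isFirst {p q r : ℕ} {u : Word (n + 1) D} (h : IsSkel p q r u) :
    ∃ hadm : 1 ≤ p ∧ p + 2 ≤ q ∧ q + 2 ≤ r ∧ r ≤ n,
      ¬ IsFirst u ⟨p, by omega⟩ ∧ ¬ IsFirst u ⟨q, by omega⟩ ∧ ¬ IsFirst u ⟨r, by omega⟩ := by
  obtain ⟨hadm, hp, hq, hr, -⟩ := h
  have z : ∀ (x : ℕ) (hx : x < n + 1), 1 ≤ x → (0 : Fin (n + 1)) < ⟨x, hx⟩ := fun x hx h1 =>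
    Fin.pos_iff_ne_zero.2 fun e => by have := congrArg Fin.val e; simp at this; omega
  refine ⟨hadm, ?_, ?_, ?_⟩
  · exact not_isFirst_of_axis_eq u (z p (by omega) (by omega)) (by rw [hp])
  · exact not_isFirst_of_axis_eq u (z q (by omega) (by omega)) (by rw [hq]; rfl)
  · exact not_isFirst_of_axis_eq u (z r (by omega) (by omega)) (by rw [hr])

/-- In a balanced block every lateral letter has a reversed partner inside the block. [cite: MadrasSlade1993, Definition 1.2.4; lane lemma] -/
theorem exists_partner_of_balanced (u : Word (n + 1) D) {i j : ℕ}
    (hbal : ∑ x ∈ Finset.univ.filter (fun x : Fin (n + 1) => i ≤ x.val ∧ x.val < j), stepVec (u x) = (0 : Site D))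
    (a : Fin (n + 1)) (ha : i ≤ a.val ∧ a.val < j) :
    ∃ b : Fin (n + 1), (i ≤ b.val ∧ b.val < j) ∧ b ≠ a ∧ u b = revIdx (u a) := by
  classical
  rw [WordTypes.sum_stepVec_eq_zero_iff] at hbal
  have h := hbal (u a).1
  rcases hs : (u a).2 with _ | _
  · -- `u a = (x, false)`: some `(x, true)` in the block
    have hmem : a ∈ (Finset.univ.filter (fun x : Fin (n + 1) => i ≤ x.val ∧ x.val < j)).filter fun x => u x = ((u a).1, false) := by
      simp only [Finset.mem_filter, Finset.mem_univ, true_and]; exact ⟨ha, by rw [← hs]⟩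
    have hpos : 0 < ((Finset.univ.filter (fun x : Fin (n + 1) => i ≤ x.val ∧ x.val < j)).filter
        fun x => u x = ((u a).1, true)).card := by
      have := Finset.card_pos.2 ⟨a, hmem⟩; omega
    obtain ⟨b, hb⟩ := Finset.card_pos.1 hpos
    simp only [Finset.mem_filter, Finset.mem_univ, true_and] at hb
    refine ⟨b, hb.1, fun e => ?_, ?_⟩
    · rw [e] at hb; have := congrArg Prod.snd hb.2; rw [hs] at this; exact Bool.noConfusion this
    · rw [hb.2, revIdx_eq, hs]; rfl
  · have hmem : a ∈ (Finset.univ.filter (fun x : Fin (n + 1) => i ≤ x.val ∧ x.val < j)).filter fun x => u x = ((u a).1, true) := by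
      simp only [Finset.mem_filter, Finset.mem_univ, true_and]; exact ⟨ha, by rw [← hs]⟩
    have hpos : 0 < ((Finset.univ.filter (fun x : Fin (n + 1) => i ≤ x.val ∧ x.val < j)).filter
        fun x => u x = ((u a).1, false)).card := by
      have := Finset.card_pos.2 ⟨a, hmem⟩; omega
    obtain ⟨b, hb⟩ := Finset.card_pos.1 hpos
    simp only [Finset.mem_filter, Finset.mem_univ, true_and] at hb
    refine ⟨b, hb.1, fun e => ?_, ?_⟩
    · rw [e] at hb; have := congrArg Prod.snd hb.2; rw [hs] at this; exact Bool.noConfusion this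
    · rw [hb.2, revIdx_eq, hs]; rfl

/-- The vertical balance of a balanced block: as many `f` as `f̄`. [cite: MadrasSlade1993, Definition 1.2.4; lane lemma] -/
theorem card_first_eq_card_rev_of_balanced (u : Word (n + 1) D) {i j : ℕ}
    (hbal : ∑ x ∈ Finset.univ.filter (fun x : Fin (n + 1) => i ≤ x.val ∧ x.val < j), stepVec (u x) = (0 : Site D)) :
    ((Finset.univ.filter (fun x : Fin (n + 1) => i ≤ x.val ∧ x.val < j)).filter fun x => u x = u 0).card =
      ((Finset.univ.filter (fun x : Fin (n + 1) => i ≤ x.val ∧ x.val < j)).filter fun x => u x = revIdx (u 0)).card := by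
  classical
  rw [WordTypes.sum_stepVec_eq_zero_iff] at hbal
  have h := hbal (u 0).1
  rcases h0 : u 0 with ⟨y, t⟩
  rw [h0] at h
  simp only at h
  have er : revIdx (y, t) = (y, !t) := rfl
  rw [er]
  cases t
  · simp only [Bool.not_false]; exact_mod_cast h.symm
  · simp only [Bool.not_true]; exact_mod_cast h

/-- ★★ THE LOCAL EXCLUSIONS SUFFICE: a skeleton word with at most one lateral axis coincidence (`numAxes u ≥ n − 3`, i.e. `≥ c − 2`)
that satisfies the local exclusions is self-avoiding. [cite: MadrasSlade1993, §1.1 (p. 3); §4.2 (p. 94); lane theorem] -/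
theorem isSAW_of_localOK {p q r : ℕ} {u : Word (n + 1) D} (hsk : IsSkel p q r u) (hloc : LocalOK p q r u)
    (hnum : n ≤ numAxes u + 3) : Percolation.IsSAW u := by
  classical
  obtain ⟨hadm, np, nq, nr⟩ := hsk.not_isFirst
  obtain ⟨hadm', hp, hq, hr, hoff⟩ := hsk
  obtain ⟨c1, c2, c3, c4, c5⟩ := hloc
  -- it suffices to rule out `wordPos i = wordPos j` for `i < j`
  suffices key : ∀ i j : ℕ, i < j → j ≤ n + 1 → wordPos u i ≠ wordPos u j by
    intro i j hi hj heq
    rcases lt_trichotomy i j with h | h | h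
    · exact absurd heq (key i j h hj)
    · exact h
    · exact absurd heq.symm (key j i h hi)
  intro i j hij hj heq
  have hbal : ∑ x ∈ Finset.univ.filter (fun x : Fin (n + 1) => i ≤ x.val ∧ x.val < j), stepVec (u x) = (0 : Site D) := by
    have := wordPos_eq_add_sum_block u hij.le hj
    rw [← heq] at this
    exact (add_eq_left.1 this.symm)
  -- lateral positions of the block: each has a partner; three of them are too many
  have partner := exists_partner_of_balanced u hbal
  have lat_nf : ∀ a b : Fin (n + 1), a < b → u b = revIdx (u a) → (u a).1 ≠ (u 0).1 → ¬ IsFirst u b := by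
    intro a b hab e _
    exact not_isFirst_of_axis_eq u hab (by rw [e]; rfl)
  have lateral_of_partner : ∀ a b : Fin (n + 1), u b = revIdx (u a) → (u a).1 ≠ (u 0).1 → (u b).1 ≠ (u 0).1 := by
    intro a b e ha; rw [e]; exact ha
  -- any lateral position is none of `0, p, q, r`
  have lat_ne : ∀ a : Fin (n + 1), (u a).1 ≠ (u 0).1 → a.val ≠ 0 ∧ a.val ≠ p ∧ a.val ≠ q ∧ a.val ≠ r := by
    intro a ha
    refine ⟨fun e => ha (by rw [show a = 0 from Fin.ext e]), fun e => ha ?_, fun e => ha ?_, fun e => ha ?_⟩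
    · rw [show a = ⟨p, by omega⟩ from Fin.ext e, hp]
    · rw [show a = ⟨q, by omega⟩ from Fin.ext e, hq]; rfl
    · rw [show a = ⟨r, by omega⟩ from Fin.ext e, hr]
  -- THREE distinct lateral positions in the block are impossible
  have no_three : ∀ a b d : Fin (n + 1), (i ≤ a.val ∧ a.val < j) → (i ≤ b.val ∧ b.val < j) → (i ≤ d.val ∧ d.val < j) →
      (u a).1 ≠ (u 0).1 → (u b).1 ≠ (u 0).1 → (u d).1 ≠ (u 0).1 → a ≠ b → a ≠ d → b ≠ d → False := by
    intro a b d ha hb hdd la lb ld hab had hbd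
    -- two distinct lateral non-first positions among the block's laterals
    have two_nf : ∃ x y : Fin (n + 1), x ≠ y ∧ (u x).1 ≠ (u 0).1 ∧ (u y).1 ≠ (u 0).1 ∧ ¬ IsFirst u x ∧ ¬ IsFirst u y := by
      -- the later of two distinct same-axis positions is non-first
      have later : ∀ x y : Fin (n + 1), x ≠ y → (u x).1 = (u y).1 →
          ∃ z : Fin (n + 1), (z = x ∨ z = y) ∧ x ≤ z ∧ y ≤ z ∧ ¬ IsFirst u z := by
        intro x y hxy exy
        rcases lt_or_gt_of_ne hxy with h | h
        · exact ⟨y, Or.inr rfl, h.le, le_rfl, not_isFirst_of_axis_eq u h exy⟩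
        · exact ⟨x, Or.inl rfl, le_rfl, h.le, not_isFirst_of_axis_eq u h exy.symm⟩
      obtain ⟨a', ha', haa', ea⟩ := partner a ha
      have ax_a' : (u a).1 = (u a').1 := by rw [ea]; rfl
      -- a third lateral `e ∉ {a, a'}` among `b, d`
      obtain ⟨e, he, le, hea, hea'⟩ : ∃ e : Fin (n + 1), (i ≤ e.val ∧ e.val < j) ∧ (u e).1 ≠ (u 0).1 ∧ e ≠ a ∧ e ≠ a' := by
        by_cases hba' : b = a'
        · exact ⟨d, hdd, ld, Ne.symm had, fun e => hbd (hba'.trans e.symm)⟩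
        · exact ⟨b, hb, lb, Ne.symm hab, hba'⟩
      obtain ⟨e', he', hee', ee⟩ := partner e he
      have ax_e' : (u e).1 = (u e').1 := by rw [ee]; rfl
      obtain ⟨z₁, hz₁, az₁, a'z₁, nz₁⟩ := later a a' (Ne.symm haa') ax_a'
      obtain ⟨z₂, hz₂, ez₂, e'z₂, nz₂⟩ := later e e' (Ne.symm hee') ax_e'
      have lz₁ : (u z₁).1 ≠ (u 0).1 := by rcases hz₁ with rfl | rfl; exact la; rw [← ax_a']; exact la
      have lz₂ : (u z₂).1 ≠ (u 0).1 := by rcases hz₂ with rfl | rfl; exact le; rw [← ax_e']; exact le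
      by_cases hzz : z₁ = z₂
      · -- `m := z₁ = z₂`; then `m = e'` (as `e ∉ {a, a'}`), and the other element `o` of `{a, a'}` carries the letter `u e`
        have hme : z₁ = e' := by
          rcases hz₂ with h | h
          · exfalso
            rcases hz₁ with h1 | h1
            · exact hea (by rw [← h, ← hzz, h1])
            · exact hea' (by rw [← h, ← hzz, h1])
          · rw [hzz, h]
        obtain ⟨o, ho_mem, ho_ne⟩ : ∃ o : Fin (n + 1), (o = a ∨ o = a') ∧ o ≠ z₁ := by
          rcases hz₁ with h1 | h1
          · exact ⟨a', Or.inr rfl, fun h => haa' (h.trans h1)⟩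
          · exact ⟨a, Or.inl rfl, fun h => haa' (h1.symm ▸ h ▸ rfl)⟩
        have huo : u o = revIdx (u z₁) := by
          rcases ho_mem with rfl | rfl <;> rcases hz₁ with h1 | h1
          · exact absurd h1.symm ho_ne
          · rw [h1, ea, revIdx_revIdx]
          · rw [h1, ea]
          · exact absurd h1.symm ho_ne
        have hue : u e = revIdx (u z₁) := by rw [hme, ee, revIdx_revIdx]
        have hoe : o ≠ e := by
          rcases ho_mem with rfl | rfl
          · exact Ne.symm hea
          · exact Ne.symm hea'
        have ax_oe : (u o).1 = (u e).1 := by rw [huo, hue]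
        obtain ⟨z₃, hz₃, oz₃, ez₃, nz₃⟩ := later o e hoe ax_oe
        have ho_lt : o < z₁ := lt_of_le_of_ne (by rcases ho_mem with rfl | rfl; exact az₁; exact a'z₁) ho_ne
        have he_lt : e < z₁ := by rw [hme]; exact lt_of_le_of_ne (by rw [← hme, hzz]; exact ez₂) (Ne.symm hee')
        have hz₃1 : z₃ ≠ z₁ := by
          rcases hz₃ with rfl | rfl
          · exact ne_of_lt ho_lt
          · exact ne_of_lt he_lt
        refine ⟨z₃, z₁, hz₃1, ?_, lz₁, nz₃, nz₁⟩
        rcases hz₃ with rfl | rfl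
        · rw [ax_oe]; exact le
        · exact le
      · exact ⟨z₁, z₂, hzz, lz₁, lz₂, nz₁, nz₂⟩
    obtain ⟨x, y, hxy, lx, ly, nx, ny⟩ := two_nf
    obtain ⟨x0, xp, xq, xr⟩ := lat_ne x lx
    obtain ⟨y0, yp, yq, yr⟩ := lat_ne y ly
    have hxyv : x.val ≠ y.val := fun e => hxy (Fin.ext e)
    exact false_of_five_nonFirst hnum p q r x.val y.val (by omega) (by omega) (by omega) x.2 y.2
      ⟨by omega, by omega, Ne.symm xp, Ne.symm yp, by omega, Ne.symm xq, Ne.symm yq, Ne.symm xr, Ne.symm yr, hxyv⟩ np nq nr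
      (by simpa using nx) (by simpa using ny)
  -- laterality of a position outside `{0, p, q, r}`
  have lat : ∀ (x : ℕ) (hx : x < n + 1), x ≠ 0 → x ≠ p → x ≠ q → x ≠ r → (u ⟨x, hx⟩).1 ≠ (u 0).1 :=
    fun x hx h0 h1 h2 h3 => hoff ⟨x, hx⟩ h0 h1 h2 h3
  -- the partner of a lateral position `x` of the block is forced to be `y` when every other lateral of the block would be a third one
  have partner_nat : ∀ (x : ℕ) (hx : x < n + 1), (i ≤ x ∧ x < j) → (u ⟨x, hx⟩).1 ≠ (u 0).1 →
      ∃ (t : ℕ) (ht : t < n + 1), (i ≤ t ∧ t < j) ∧ t ≠ x ∧ u ⟨t, ht⟩ = revIdx (u ⟨x, hx⟩) ∧ (u ⟨t, ht⟩).1 ≠ (u 0).1 := by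
    intro x hx hxB lx
    obtain ⟨b, hb, hbx, eb⟩ := partner ⟨x, hx⟩ hxB
    exact ⟨b.val, b.2, hb, fun e => hbx (Fin.ext e), eb, lateral_of_partner _ _ eb lx⟩
  have three : ∀ (x y z : ℕ) (hx : x < n + 1) (hy : y < n + 1) (hz : z < n + 1), (i ≤ x ∧ x < j) → (i ≤ y ∧ y < j) →
      (i ≤ z ∧ z < j) → (u ⟨x, hx⟩).1 ≠ (u 0).1 → (u ⟨y, hy⟩).1 ≠ (u 0).1 → (u ⟨z, hz⟩).1 ≠ (u 0).1 →
      x ≠ y → x ≠ z → y ≠ z → False := by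
    intro x y z hx hy hz bx bY bz lx ly lz h1 h2 h3
    exact no_three ⟨x, hx⟩ ⟨y, hy⟩ ⟨z, hz⟩ bx bY bz lx ly lz (fun e => h1 (congrArg Fin.val e)) (fun e => h2 (congrArg Fin.val e))
      (fun e => h3 (congrArg Fin.val e))
  -- a vertical letter `u x = u 0` in the block has `x ∈ {0, p, r}`; `u x = f̄` has `x = q`
  have hskel : IsSkel p q r u := ⟨hadm', hp, hq, hr, hoff⟩
  have hvb := card_first_eq_card_rev_of_balanced u hbal
  by_cases hqB : i ≤ q ∧ q < j
  · -- `q ∈ B`: exactly one `f` in the block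
    have hrev1 : ((Finset.univ.filter (fun x : Fin (n + 1) => i ≤ x.val ∧ x.val < j)).filter
        fun x => u x = revIdx (u 0)) = {⟨q, by omega⟩} := by
      ext x
      simp only [Finset.mem_filter, Finset.mem_univ, true_and, Finset.mem_singleton, hskel.eq_rev_iff, Fin.ext_iff]
      constructor
      · rintro ⟨-, h⟩; exact h
      · intro h; exact ⟨by omega, h⟩
    rw [hrev1, Finset.card_singleton, Finset.card_eq_one] at hvb
    obtain ⟨v, hv⟩ := hvb
    have hvmem : (i ≤ v.val ∧ v.val < j) ∧ u v = u 0 := by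
      have : v ∈ ((Finset.univ.filter (fun x : Fin (n + 1) => i ≤ x.val ∧ x.val < j)).filter fun x => u x = u 0) := by
        rw [hv]; exact Finset.mem_singleton_self _
      simpa using this
    have huniq : ∀ x : Fin (n + 1), (i ≤ x.val ∧ x.val < j) → u x = u 0 → x = v := by
      intro x hxB hx
      have : x ∈ ((Finset.univ.filter (fun x : Fin (n + 1) => i ≤ x.val ∧ x.val < j)).filter fun x => u x = u 0) := by
        simp [hxB, hx]
      rw [hv] at this; simpa using this
    have hv0pr := (hskel.eq_first_iff v).1 hvmem.2
    rcases hv0pr with hv0 | hvp | hvr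
    · -- `0 ∈ B` ⇒ `i = 0`; `p ∉ B` (uniqueness) but `p < q < j`
      have hi0 : i = 0 := by have := hvmem.1.1; omega
      have hpv : (⟨p, by omega⟩ : Fin (n + 1)) = v := huniq ⟨p, by omega⟩ ⟨show i ≤ p by omega, show p < j by omega⟩ hp
      have : p = v.val := congrArg Fin.val hpv
      omega
    · -- `p ∈ B`, `0 ∉ B`, `r ∉ B`
      have hpB : i ≤ p ∧ p < j := by rw [← hvp]; exact hvmem.1
      have hrB : ¬ (r < j) := by
        intro hrj
        have : r = v.val := congrArg Fin.val (huniq ⟨r, by omega⟩ ⟨show i ≤ r by omega, show r < j from hrj⟩ hr)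
        omega
      have hi1 : 1 ≤ i := by
        by_contra h0
        have e := huniq 0 ⟨by simp; omega, by simp; omega⟩ rfl
        have : (0 : Fin (n + 1)).val = v.val := congrArg Fin.val e
        simp at this; omega
      -- the laterals strictly between `p` and `q`
      have l1 := lat (p + 1) (by omega) (by omega) (by omega) (by omega) (by omega)
      by_cases hq3 : p + 4 ≤ q
      · exact three (p + 1) (p + 2) (p + 3) (by omega) (by omega) (by omega) ⟨by omega, by omega⟩ ⟨by omega, by omega⟩
          ⟨by omega, by omega⟩ l1 (lat (p + 2) (by omega) (by omega) (by omega) (by omega) (by omega))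
          (lat (p + 3) (by omega) (by omega) (by omega) (by omega) (by omega)) (by omega) (by omega) (by omega)
      · by_cases hq2 : q = p + 3
        · have l2 := lat (p + 2) (by omega) (by omega) (by omega) (by omega) (by omega)
          obtain ⟨t, ht, tB, tne, et, lt⟩ := partner_nat (p + 1) (by omega) ⟨by omega, by omega⟩ l1
          by_cases htp : t = p + 2
          · subst htp
            exact c1 (p + 1) (by omega) (by omega) (by omega) (by omega) (by omega) (by omega) (by omega) (by omega) et
          · exact three (p + 1) (p + 2) t (by omega) (by omega) ht ⟨by omega, by omega⟩ ⟨by omega, by omega⟩ tB l1 l2 lt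
              (by omega) (Ne.symm tne) (Ne.symm htp)
        · have hq1 : q = p + 2 := by omega
          obtain ⟨t, ht, tB, tne, et, lt⟩ := partner_nat (p + 1) (by omega) ⟨by omega, by omega⟩ l1
          obtain ⟨t0, tp, tq, tr⟩ := lat_ne ⟨t, ht⟩ lt
          simp only at t0 tp tq tr
          rcases Nat.lt_or_ge t p with htl | htg
          · -- `t < p`: then `t = p − 1`
            by_cases htp : t = p - 1
            · have hp2 : 2 ≤ p := by omega
              refine c2 hq1 hp2 (by omega) ?_
              rw [apply_mk_congr u (show p - 1 = t by omega), et, revIdx_revIdx]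
            · exact three (p + 1) (p - 1) t (by omega) (by omega) ht ⟨by omega, by omega⟩ ⟨by omega, by omega⟩ tB l1
                (lat (p - 1) (by omega) (by omega) (by omega) (by omega) (by omega)) lt (by omega) (Ne.symm tne) (by omega)
          · -- `t > q`: then `t = q + 1`
            by_cases htq : t = q + 1
            · refine c3 hq1 (by omega) ?_
              rw [apply_mk_congr u (show q + 1 = t by omega), et]
            · exact three (p + 1) (q + 1) t (by omega) (by omega) ht ⟨by omega, by omega⟩ ⟨by omega, by omega⟩ tB l1
                (lat (q + 1) (by omega) (by omega) (by omega) (by omega) (by omega)) lt (by omega) (Ne.symm tne) (by omega)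
    · -- `r ∈ B`, `p ∉ B`, `0 ∉ B`
      have hrB : i ≤ r ∧ r < j := by rw [← hvr]; exact hvmem.1
      have hpB : ¬ (i ≤ p) := by
        intro hip
        have : p = v.val := congrArg Fin.val (huniq ⟨p, by omega⟩ ⟨show i ≤ p from hip, show p < j by omega⟩ hp)
        omega
      have l1 := lat (q + 1) (by omega) (by omega) (by omega) (by omega) (by omega)
      by_cases hr3 : q + 4 ≤ r
      · exact three (q + 1) (q + 2) (q + 3) (by omega) (by omega) (by omega) ⟨by omega, by omega⟩ ⟨by omega, by omega⟩
          ⟨by omega, by omega⟩ l1 (lat (q + 2) (by omega) (by omega) (by omega) (by omega) (by omega))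
          (lat (q + 3) (by omega) (by omega) (by omega) (by omega) (by omega)) (by omega) (by omega) (by omega)
      · by_cases hr2 : r = q + 3
        · have l2 := lat (q + 2) (by omega) (by omega) (by omega) (by omega) (by omega)
          obtain ⟨t, ht, tB, tne, et, lt⟩ := partner_nat (q + 1) (by omega) ⟨by omega, by omega⟩ l1
          by_cases htq : t = q + 2
          · subst htq
            exact c1 (q + 1) (by omega) (by omega) (by omega) (by omega) (by omega) (by omega) (by omega) (by omega) et
          · exact three (q + 1) (q + 2) t (by omega) (by omega) ht ⟨by omega, by omega⟩ ⟨by omega, by omega⟩ tB l1 l2 lt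
              (by omega) (Ne.symm tne) (Ne.symm htq)
        · have hr1 : r = q + 2 := by omega
          obtain ⟨t, ht, tB, tne, et, lt⟩ := partner_nat (q + 1) (by omega) ⟨by omega, by omega⟩ l1
          obtain ⟨t0, tp, tq, tr⟩ := lat_ne ⟨t, ht⟩ lt
          simp only at t0 tp tq tr
          rcases Nat.lt_or_ge t q with htl | htg
          · by_cases htp : t = q - 1
            · refine c4 hr1 (by omega) (by omega) ?_
              rw [apply_mk_congr u (show q - 1 = t by omega), et, revIdx_revIdx]
            · exact three (q + 1) (q - 1) t (by omega) (by omega) ht ⟨by omega, by omega⟩ ⟨by omega, by omega⟩ tB l1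
                (lat (q - 1) (by omega) (by omega) (by omega) (by omega) (by omega)) lt (by omega) (Ne.symm tne) (by omega)
          · by_cases htr : t = r + 1
            · refine c5 hr1 (by omega) ?_
              rw [apply_mk_congr u (show r + 1 = t by omega), et]
            · exact three (q + 1) (r + 1) t (by omega) (by omega) ht ⟨by omega, by omega⟩ ⟨by omega, by omega⟩ tB l1
                (lat (r + 1) (by omega) (by omega) (by omega) (by omega) (by omega)) lt (by omega) (Ne.symm tne) (by omega)
  · -- `q ∉ B`: no vertical letters in the block at all
    have hrev0 : ((Finset.univ.filter (fun x : Fin (n + 1) => i ≤ x.val ∧ x.val < j)).filter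
        fun x => u x = revIdx (u 0)) = ∅ := by
      refine Finset.filter_eq_empty_iff.2 fun x hx h => hqB ?_
      have := (hskel.eq_rev_iff x).1 h
      have hxB := (Finset.mem_filter.1 hx).2
      omega
    rw [hrev0, Finset.card_empty, Finset.card_eq_zero, Finset.filter_eq_empty_iff] at hvb
    have novert : ∀ (x : ℕ) (hx : x < n + 1), (i ≤ x ∧ x < j) → x ≠ 0 ∧ x ≠ p ∧ x ≠ q ∧ x ≠ r := by
      intro x hx hxB
      have h1 : u ⟨x, hx⟩ ≠ u 0 := hvb (by simp [hxB])
      have h2 : ¬ (x = 0 ∨ x = p ∨ x = r) := fun h => h1 ((hskel.eq_first_iff ⟨x, hx⟩).2 h)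
      push Not at h2
      exact ⟨h2.1, h2.2.1, by omega, h2.2.2⟩
    obtain ⟨i0, ip, iq, ir⟩ := novert i (by omega) ⟨le_rfl, hij⟩
    have li := lat i (by omega) i0 ip iq ir
    by_cases hj3 : i + 3 ≤ j
    · obtain ⟨a0, ap, aq, ar⟩ := novert (i + 1) (by omega) ⟨by omega, by omega⟩
      obtain ⟨b0, bp, bq, br⟩ := novert (i + 2) (by omega) ⟨by omega, by omega⟩
      exact three i (i + 1) (i + 2) (by omega) (by omega) (by omega) ⟨le_rfl, hij⟩ ⟨by omega, by omega⟩ ⟨by omega, by omega⟩ li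
        (lat (i + 1) (by omega) a0 ap aq ar) (lat (i + 2) (by omega) b0 bp bq br) (by omega) (by omega) (by omega)
    · obtain ⟨t, ht, tB, tne, et, lt⟩ := partner_nat i (by omega) ⟨le_rfl, hij⟩ li
      have htj : t = i + 1 := by omega
      subst htj
      obtain ⟨a0, ap, aq, ar⟩ := novert (i + 1) (by omega) ⟨by omega, by omega⟩
      exact c1 i ht i0 ip iq ir ap aq ar et

/-- ★★★ THE SECOND CLASS, LOCALLY: for a word of length `c + 2` with at least `c − 2` axes, membership in the bridge class of cost `c` is
EQUIVALENT to being a skeleton word `f … f … f̄ … f` satisfying the local exclusions (no adjacent lateral reversal, none of the four vertical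
unit squares). [cite: MadrasSlade1993, §4.2 (p. 94); §1.1 (p. 3); lane theorem] -/
theorem qb_iff_exists_isSkel_localOK {c : ℕ} {u : Word (n + 1) D} (hn : n = c + 1) (hax : c ≤ numAxes u + 2) :
    QB c u ↔ ∃ p q r, IsSkel p q r u ∧ LocalOK p q r u := by
  constructor
  · intro hqb
    obtain ⟨p, q, r, hsk⟩ := exists_isSkel_of_qb hn hqb hax
    exact ⟨p, q, r, hsk, localOK_of_isSAW hsk hqb.1⟩
  · rintro ⟨p, q, r, hsk, hloc⟩
    refine ⟨isSAW_of_localOK hsk hloc (by omega), hsk.isIrrH, ?_⟩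
    rw [hsk.hgt_last]
    have : (2 : ℤ).toNat = 2 := rfl
    rw [this]
    omega

end SpanTwoRigidity

end WordTypes

end Literature.Probability.RandomPlanarGeometry.SAW.Zd

end
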